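import Literature.AlgebraicGeometry.Resolution.CentreBlowupThm36FirstKind
import Literature.AlgebraicGeometry.Resolution.CentreBlowupThm36SecondKind
import HarnessLib

/-!
# [CP19] Theorem 3.6 (1) "`ε(y) = ε(x) = ω(x)`" for EVERY permissible coordinate centre, in the model

Topic: `Literature/AlgebraicGeometry/Resolution`.  Cell `pub-rosobs`, unit `pub-rosobs-carver-g25`.
Combination of `CentreBlowupThm36FirstKind.lean` (first-kind centres, by transfer through the Moh lift)
and `CentreBlowupThm36SecondKind.lean` (second-kind centres: no increase of `ε` at all; unit carver-g24).

* V. Cossart, O. Piltant, *Resolution of singularities of arithmetical threefolds*, J. Algebra **529**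
  (2019) 268–535 = arXiv:1412.0868 [CossartPiltant2019], Theorem 3.6 (p. 35): "Let `π : 𝒳' → 𝒳` be
  the blowing up along a permissible center `𝒴` (of the first kind or second kind) at `x`,
  `x' ∈ π⁻¹(x)` … If `ε(x') > ε(x)`, the following holds: (1) we have `i₀(m_S) = p`,
  `ε(y) = ε(x) = ω(x)`, …".

## What is proved (`p` prime, `char K = p`, every finite index type `σ`; namespace `CentreBlowup.CState`)

* `not_epsilonIncreases_of_isPermissibleCentre_of_vNonzero` — `V(F_{p,Z},E,m_S) ≠ 0` forbids any
  increase of `ε` under the blow-up of a permissible centre of either kind, at every point over `x`;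
* `isFirstKind_of_epsilonIncreases` — an increase of `ε` forces the centre to be of the first kind and
  `ω(x) = ε(x)`;
* **`epsilonIncreaseForcesFirstKindAt`** — the atlas predicate `EpsilonIncreaseForcesFirstKindAt p S j b s`
  of `CentreBlowupAdaptedOrder.lean` HOLDS FOR EVERY `S`, `j`, `b`, `s` (its hypotheses
  `IsEquimultiplePoint`, `0 < ω(x) < ⊤` are not used).

## Scope (what this is NOT)

As in the two imported files: the cell's combinatorial model only (fixed coordinates, `G = 0`, perfect-
field reading, points of the fibre over `x`); the clause `i₀(m_S) = p` and assertion (2) are not treated.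
-/

noncomputable section

open MvPolynomial Finset

/-! ## Every permissible centre: [CP19, Thm. 3.6 (1)] "`ε(y) = ε(x) = ω(x)`" in the model -/

namespace Literature.AlgebraicGeometry.Resolution.CentreBlowup.CState

section Permissible

variable {σ : Type*} {K : Type*} [Field K] [Fintype σ] [DecidableEq σ] [DecidableEq K]
variable (p : ℕ) [hp : Fact p.Prime] [CharP K p]

/-- **`V(F_{p,Z},E,m_S) ≠ 0` forbids an increase of `ε` under the blow-up of ANY permissible centre**
(first or second kind), at every point of the fibre over `x` in every chart `j ∈ S`.
[cite: CossartPiltant2019, Thm. 3.6 (1) (p. 35)] -/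
theorem not_epsilonIncreases_of_isPermissibleCentre_of_vNonzero {S : Finset σ} {j : σ} (hj : j ∈ S)
    (b : σ → K) (hbj : b j = 0) (hbN : ∀ i, i ∉ S → b i = 0) (s : CState σ K)
    (hperm : IsPermissibleCentre p S s) (hV : PointBlowup.VNonzero s.exc s.F) :
    ¬ EpsilonIncreases p S j b s := by
  rcases hperm with h1 | h2
  · exact not_epsilonIncreases_of_isFirstKind_of_vNonzero p hj b hbj hbN s h1 hV
  · exact SecondKind.not_epsilonIncreases_of_isSecondKind p hp.out.one_lt.ne' hj b hbj hbN s h2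

/-- **An increase of `ε` under the blow-up of a permissible centre forces the centre to be of the
first kind and `ω(x) = ε(x)`.** [cite: CossartPiltant2019, Thm. 3.6 (1) (p. 35)] -/
theorem isFirstKind_of_epsilonIncreases {S : Finset σ} {j : σ} (hj : j ∈ S) (b : σ → K)
    (hbj : b j = 0) (hbN : ∀ i, i ∉ S → b i = 0) (s : CState σ K) (hperm : IsPermissibleCentre p S s)
    (hinc : EpsilonIncreases p S j b s) : IsFirstKind p S s ∧ s.omega = s.epsilon := by
  rcases hperm with h1 | h2
  · exact ⟨h1, omega_eq_epsilon_of_epsilonIncreases_of_isFirstKind p hj b hbj hbN s h1 hinc⟩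
  · exact absurd hinc (SecondKind.not_epsilonIncreases_of_isSecondKind p hp.out.one_lt.ne' hj b hbj
      hbN s h2)

/-- **[CP19, Thm. 3.6 (1)] "if `ε(x') > ε(x)` … `ε(y) = ε(x) = ω(x)`" READ AT ONE BLOW-UP OF A
PERMISSIBLE COORDINATE CENTRE HOLDS IN THE MODEL: the atlas predicate
`EpsilonIncreaseForcesFirstKindAt p S j b s` of `CentreBlowupAdaptedOrder.lean` is a theorem for every
set of centre variables `S`, every chart `j`, every point `b` and every state `s`** (its hypotheses
`IsEquimultiplePoint`, `0 < ω(x) < ⊤` are not used). [cite: CossartPiltant2019, Thm. 3.6 (1) (p. 35)] -/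
theorem epsilonIncreaseForcesFirstKindAt (S : Finset σ) (j : σ) (b : σ → K) (s : CState σ K) :
    EpsilonIncreaseForcesFirstKindAt p S j b s := by
  intro hj hbj hbN hperm _ _ _ hinc
  obtain ⟨h1, hω⟩ := isFirstKind_of_epsilonIncreases p hj b hbj hbN s hperm hinc
  exact ⟨h1.2, hω⟩

end Permissible

end Literature.AlgebraicGeometry.Resolution.CentreBlowup.CState

end
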